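import Literature.Computability.Complexity.OracleSubroutineRand
import HarnessLib

/-!
# Non-adaptive oracle DECIDERS with listed answers, and randomised subroutines: the shape of a black-box decision reduction

Topic `Literature/Computability/Complexity`, companion of `TruthTableClosure.lean` (`ttAlg Q q D : OracleAlg Bool`,
the truth-table DECIDER: ask `Q ⟨x, 1ⁱ⟩`, `i < q(|x|)`, then accept iff `⟨x, flattened answers⟩ ∈ D` —
answers flattened, the format of a language oracle), of `TruthTableTransducers.lean` (`ttFnAlgL`: the
transducer keeping the answers of an ARBITRARY oracle as the `listBool`-coded list `ttQueries`) and of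
`OracleSubroutineRand.lean` (`exists_polyTime_ttRandSubroutine`: run a randomised subroutine `R` on the
computed inputs, uniformly in the oracle). A black-box DECISION reduction run against an adversarially
specified oracle — the first component of Peikert's `GapSVP → LWE` reduction (`Cryptography/PeikertReduction.lean`,
hypothesis `h₁` of `peikert_gapSVPZeta_to_lwe_classical_of_components`, pqc.S20: call the BDD solver `N`
times on freshly perturbed instances, "accept iff some answer differs from `x - w`") — needs the DECIDER
with LISTED answers and Bool output (`OracleAlg Bool`, `IsPolyTime encodingBoolBool`, the format of the
conclusion of pqc.S20). This file provides it, with the same proofs: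

* `ttAlgL Q q D : OracleAlg Bool` — ask `Q ⟨x, 1ⁱ⟩` for `i < q(|x|)`, then accept iff
  `⟨x, code [a₀, …, a_{q(|x|)-1}]⟩ ∈ D`; `ttDecL Q q D O x` — its verdict against the oracle `O`;
* `trans_ttAlgL`, **`run_ttAlgL`** (within any budget `> q(|x|)`, against EVERY oracle),
  `exists_of_mem_queries_ttAlgL`, `length_le_of_mem_queries_ttAlgL`;
* `decSL`, `stepSDL`, `stepSDL_apply`, **`isPolyTime_ttAlgL`** (`Q ∈ FP`, `D ∈ P`);
* `run_ttAlgL_budget` and **`exists_polyTime_ttRandDecider`** — for `Q ∈ FP`, `D ∈ P`, a polynomial `q`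
  and a polynomial-time randomised subroutine `R` (round budget `fuel` in the length of its proper
  input, default answer `d₀` on a time-out): ONE polynomial-time `C : OracleAlg Bool` and ONE polynomial
  `qC` with `C.run O (qC |x|) x = some (ttDecL Q q D (randAnswer R fuel d₀ O) x)` for EVERY oracle `O` and
  input `x`.

## References

* R. E. Ladner, N. A. Lynch, A. L. Selman, *A comparison of polynomial time reducibilities*,
  Theoret. Comput. Sci. 1 (1975) 103–123, §3 (`≤ᵖₜₜ`) [LadnerLynchSelman1975].
* S. Arora, B. Barak, *Computational Complexity: A Modern Approach*, CUP 2009, §3.4 with §1.4.1 and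
  Def. 7.1 [AroraBarak2009].
* C. Peikert, *Public-key cryptosystems from the worst-case shortest vector problem*, STOC 2009, proof
  of Thm. 3.1 (the consumer) [Peikert2009].
-/

namespace Literature.Computability.Complexity

open _root_.Computability Polynomial PRelSigma OracleCompose TTClosure

section TTAlgL

variable (Q : List Bool → List Bool) (q : Polynomial ℕ) (D : Language Bool)

/-- **The truth-table decider reading coded answers**: while fewer than `q(|x|)` answers have been
received ask `Q ⟨x, 1^{#answers}⟩`; then accept iff `⟨x, code of the answer list⟩ ∈ D`.
[Ladner–Lynch–Selman 1975, §3] [cite: LadnerLynchSelman1975, §3] -/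
noncomputable def ttAlgL : OracleAlg Bool where
  step x ans :=
    if ans.length < q.eval x.length then Sum.inl (Q (boolPair x (List.replicate ans.length true)))
    else Sum.inr (D.boolIndicator (boolPair x ((encodingList Bool).listBool.encode ans)))

/-- **The verdict against the oracle `O`**: `[⟨x, code [O q₀, …, O q_{q(|x|)-1}]⟩ ∈ D]`, `qᵢ = Q ⟨x, 1ⁱ⟩`.
[Ladner–Lynch–Selman 1975, §3] [cite: LadnerLynchSelman1975, §3] -/
noncomputable def ttDecL (O : Oracle) (x : List Bool) : Bool :=
  D.boolIndicator (boolPair x ((encodingList Bool).listBool.encode ((ttQueries Q x (q.eval x.length)).map O)))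

variable {Q q D}

/-- The step of `ttAlgL` before the last query has been answered is the next query. [folklore] -/
theorem ttAlgL_step_of_lt (x : List Bool) {ans : List (List Bool)} (h : ans.length < q.eval x.length) :
    (ttAlgL Q q D).step x ans = Sum.inl (Q (boolPair x (List.replicate ans.length true))) := by
  simp [ttAlgL, h]

/-- The step of `ttAlgL` after all answers is the verdict on the coded transcript. [folklore] -/
theorem ttAlgL_step_of_le (x : List Bool) {ans : List (List Bool)} (h : q.eval x.length ≤ ans.length) :
    (ttAlgL Q q D).step x ans =
      Sum.inr (D.boolIndicator (boolPair x ((encodingList Bool).listBool.encode ans))) := by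
  simp [ttAlgL, Nat.not_lt.2 h]

/-- **The transcript of `ttAlgL` against an arbitrary oracle** is the list of the oracle's answers to the
intended queries. [folklore] -/
theorem trans_ttAlgL (O : Oracle) (x : List Bool) :
    ∀ i ≤ q.eval x.length, trans (ttAlgL Q q D) O x i = (ttQueries Q x i).map O
  | 0, _ => by simp
  | i + 1, hi => by
    have ih := trans_ttAlgL O x i (Nat.le_of_succ_le hi)
    have hlen : (List.map O (ttQueries Q x i)).length = i := by rw [List.length_map, length_ttQueries]
    rw [trans_succ, ih, qryOf_eq_of_step_eq (ttAlgL_step_of_lt x (by rw [hlen]; omega)), hlen,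
      ttQueries_succ, List.map_append, List.map_singleton]

/-- **`ttAlgL` computes `ttDecL`** within any budget of more than `q(|x|)` rounds, against every oracle.
[Ladner–Lynch–Selman 1975, §3] [cite: LadnerLynchSelman1975, §3] -/
theorem run_ttAlgL (O : Oracle) (x : List Bool) {n : ℕ} (hn : q.eval x.length < n) :
    (ttAlgL Q q D).run O n x = some (ttDecL Q q D O x) := by
  rw [run_eq_some_iff]
  refine ⟨q.eval x.length, hn, fun i hi => ⟨Q (boolPair x (List.replicate i true)), ?_⟩, ?_⟩
  · rw [trans_ttAlgL O x i hi.le, ttAlgL_step_of_lt x (by simpa using hi), List.length_map, length_ttQueries]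
  · rw [trans_ttAlgL O x _ le_rfl, ttAlgL_step_of_le x (by simp)]
    rfl

/-- **The queries of `ttAlgL` are the intended ones**, whatever the oracle and the budget. [folklore] -/
theorem exists_of_mem_queries_ttAlgL (O : Oracle) (x : List Bool) {n : ℕ} {y : List Bool}
    (hy : y ∈ (ttAlgL Q q D).queries O n x) :
    ∃ i < q.eval x.length, y = Q (boolPair x (List.replicate i true)) := by
  obtain ⟨i, -, hall, rfl⟩ := exists_of_mem_queries _ _ n x y hy
  have hi : i < q.eval x.length := by
    by_contra hle
    obtain ⟨y', hy'⟩ := hall (q.eval x.length) (Nat.not_lt.1 hle)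
    rw [trans_ttAlgL O x _ le_rfl, ttAlgL_step_of_le x (by simp)] at hy'
    cases hy'
  refine ⟨i, hi, ?_⟩
  rw [trans_ttAlgL O x i hi.le, qryOf_eq_of_step_eq (ttAlgL_step_of_lt x (by simpa using hi)),
    List.length_map, length_ttQueries]

/-- **Query lengths**: with an output-length bound `s` of `Q`, every query of `ttAlgL` on `x` has length
`≤ s(2|x| + 2 + q(|x|))`. [folklore] -/
theorem length_le_of_mem_queries_ttAlgL {s : Polynomial ℕ} (hs : ∀ w, (Q w).length ≤ s.eval w.length)
    (O : Oracle) (x : List Bool) {n : ℕ} {y : List Bool} (hy : y ∈ (ttAlgL Q q D).queries O n x) :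
    y.length ≤ s.eval (2 * x.length + 2 + q.eval x.length) := by
  obtain ⟨i, hi, rfl⟩ := exists_of_mem_queries_ttAlgL O x hy
  refine (hs _).trans ?_
  rw [length_boolPair, List.length_replicate]
  exact TM2Iter.eval_mono s (by omega)

/-! ### The step function of `ttAlgL` as a string map -/

variable (D) in
/-- The code `1 · [⟨x, code of the answers⟩ ∈ D]` of the verdict: the indicator of `D` applied to the step
input itself. [folklore] -/
noncomputable def decSL : List Bool → List Bool := List.cons true ∘ fun w => encodeBool (D.boolIndicator w)

variable (Q q D) in
/-- **The step function of `ttAlgL` as a string map.** [folklore] -/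
noncomputable def stepSDL : List Bool → List Bool := condFn (GoOn q) (qryS Q) (decSL D)

/-- `decSL D ∈ FP` for `D ∈ P`. [folklore] -/
theorem decSL_mem_FP (hD : D ∈ Classes.P) : decSL D ∈ FP := comp_mem_FP (cons_mem_FP true) (indicatorFn_mem_FP hD)

/-- **`stepSDL ∈ FP`.** [folklore] -/
theorem stepSDL_mem_FP (hQ : Q ∈ FP) (hD : D ∈ Classes.P) : stepSDL Q q D ∈ FP :=
  condFn_mem_FP (GoOn_mem_P q) (qryS_mem_FP hQ) (decSL_mem_FP hD)

/-- **The string map computes the step function.** [folklore] -/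
theorem stepSDL_apply (x : List Bool) (ans : List (List Bool)) :
    stepSDL Q q D (boolPair x ((encodingList Bool).listBool.encode ans)) = stepCode ((ttAlgL Q q D).step x ans) := by
  by_cases h : ans.length < q.eval x.length
  · rw [stepSDL, condFn_of_mem _ _ ((mem_GoOn_iff x ans).2 h), ttAlgL_step_of_lt x h, qryS_apply, stepCode_inl]
  · rw [stepSDL, condFn_of_not_mem _ _ (fun h' => h ((mem_GoOn_iff x ans).1 h')),
      ttAlgL_step_of_le x (Nat.not_lt.1 h), stepCode_inr]
    rfl

/-- **`ttAlgL` is polynomial-time** for `Q ∈ FP` and `D ∈ P`. [Ladner–Lynch–Selman 1975, §3;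
Arora–Barak 2009, §3.4] [cite: LadnerLynchSelman1975, §3] -/
theorem isPolyTime_ttAlgL (hQ : Q ∈ FP) (hD : D ∈ Classes.P) : (ttAlgL Q q D).IsPolyTime encodingBoolBool := by
  obtain ⟨p, Mx, h⟩ := stepSDL_mem_FP (q := q) hQ hD
  refine ⟨p, Mx, fun z => ?_⟩
  have hz := h (boolPair z.1 ((encodingList Bool).listBool.encode z.2))
  rw [id, stepSDL_apply] at hz
  exact hz

/-! ### Budget and randomised subroutines -/

/-- **A budget for `ttAlgL`**: with `s` an output-length bound of `Q`, the polynomial `q + 1 + s ∘ (2X + 2 + q)`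
dominates the number of rounds and the query lengths, against every oracle. [folklore] -/
theorem run_ttAlgL_budget (q s : Polynomial ℕ) (hs : ∀ w, (Q w).length ≤ s.eval w.length) (O : Oracle)
    (x : List Bool) :
    (ttAlgL Q q D).run O ((q + 1 + s.comp (2 * X + 2 + q)).eval x.length) x = some (ttDecL Q q D O x) ∧
      ∀ y ∈ (ttAlgL Q q D).queries O ((q + 1 + s.comp (2 * X + 2 + q)).eval x.length) x,
        y.length ≤ (q + 1 + s.comp (2 * X + 2 + q)).eval x.length := by
  have hev : (q + 1 + s.comp (2 * X + 2 + q)).eval x.length =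
      q.eval x.length + 1 + s.eval (2 * x.length + 2 + q.eval x.length) := by
    simp
  refine ⟨run_ttAlgL O x (by rw [hev]; omega), fun y hy => ?_⟩
  rw [hev]
  exact (length_le_of_mem_queries_ttAlgL hs O x hy).trans (Nat.le_add_left _ _)

/-- **A non-adaptive black-box DECISION reduction calling a randomised subroutine is ONE polynomial-time
oracle decider, for every oracle.** For `Q ∈ FP`, `D ∈ P`, a polynomial `q`, a polynomial-time `R` with
round budget `fuel` and a default `d₀`: there are a polynomial-time `C : OracleAlg Bool` and a polynomial
`qC` such that for EVERY oracle `O` and input `x`,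
`C.run O (qC |x|) x = some (ttDecL Q q D (randAnswer R fuel d₀ O) x)` — i.e. `C` accepts iff
`⟨x, code [a₀, …, a_{q(|x|)-1}]⟩ ∈ D` with `aⱼ = (R.run O (fuel |uⱼ|) ⟨uⱼ, cⱼ⟩).getD d₀`, `⟨uⱼ, cⱼ⟩ = Q ⟨x, 1ʲ⟩`.
[Arora–Barak 2009, §3.4 with Def. 7.1; Ladner–Lynch–Selman 1975, §3]
[cite: AroraBarak2009, §3.4] [cite: LadnerLynchSelman1975, §3] -/
theorem exists_polyTime_ttRandDecider (hQ : Q ∈ FP) (hD : D ∈ Classes.P) (q : Polynomial ℕ)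
    {R : OracleAlg (List Bool)} (hR : R.IsPolyTime (encodingList Bool)) (fuel : Polynomial ℕ) (d₀ : List Bool) :
    ∃ C : OracleAlg Bool, C.IsPolyTime encodingBoolBool ∧ ∃ qC : Polynomial ℕ,
      ∀ (O : Oracle) (x : List Bool),
        C.run O (qC.eval x.length) x = some (ttDecL Q q D (OracleAlg.randAnswer R fuel d₀ O) x) := by
  obtain ⟨s, hs⟩ := exists_poly_length_le_of_mem_FP hQ
  obtain ⟨C, hC, qC, h⟩ := OracleAlg.exists_polyTime_randSubroutine
    (isPolyTime_ttAlgL (q := q) hQ hD) hR (q + 1 + s.comp (2 * X + 2 + q)) fuel d₀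
  refine ⟨C, hC, qC, fun O x => ?_⟩
  have hb := run_ttAlgL_budget (D := D) q s hs (OracleAlg.randAnswer R fuel d₀ O) x
  exact (h O x _ hb.1 hb.2).1

end TTAlgL

end Literature.Computability.Complexity
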